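import Summits.MatrixMultiplication.OmegaCensus.ThreeSetZ4Z4Cells
import HarnessLib

/-!
# Whole orders `496`, `736`, `976` over `A ↠ ℤ₄ × ℤ₄`: the three-set cells close them

ω-census `pub-omega`, family (b3), seat pub-omega-group gen 17.  Framing: lottery ticket; floor = certified bounds/negative
ranges.  VALUE: kernel theorems about the group-theoretic method (TPP capacity of dihedral-like groups); NOT progress on ω.

`no_mod_one_law_of_onto_z4z4_threeset` extends the factorisation criterion `no_mod_one_law_of_onto_z4z4_domino` (gen 16):
for `A ↠ ℤ₄ × ℤ₄` with `|A| ≥ 14`, if EVERY factorisation `cde = (|A| − 1)/3` has a part `1` (uniform domino theorem), or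
two parts `3` (gen 14), or parts `3` and `5`, or two parts `5`, or two parts `7` (`ThreeSetZ4Z4Cells.lean`), then no
dihedral-like group over `A` (any `c₀`) has a TPP triple attaining `3|S||T||U| + 8 = 8|A|`.  ORDERS:
`496 = 3·165 + 1` (`165 = 3·5·11`), `736 = 3·245 + 1` (`245 = 5·7²`), `976 = 3·325 + 1` (`325 = 5²·13`):
`no_mod_one_law_card_496/736/976_of_onto_z4z4`; instances `no_mod_one_law_z4_z4_z31`, `no_mod_one_law_z4_z8_z23`,
`no_mod_one_law_z4_z4_z61` — the census cells `(3,5,11)@496` (`ℤ₄²×ℤ₃₁`), `(5,7,7)@736` (`ℤ₄×ℤ₈×ℤ₂₃`), `(5,5,13)@976`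
(`ℤ₄²×ℤ₆₁`), i.e. the last three open cells `≤ 1000` of groups with a `ℤ₄ × ℤ₄` quotient (CLASSIFICATION-STATUS-g16), are
KERNEL as whole orders.  CAPSTONE: **`no_mod_one_law_of_onto_z4z4_card_lt_1072`** — for EVERY finite abelian `A ↠ ℤ₄ × ℤ₄`
with `|A| < 1072` no dihedral-like group over `A` attains the law (`cube_factor_of_lt_1072`: a `decide`d check that every
factorisation `cde`, `3cde + 1 < 1072`, `16 ∣ 3cde + 1`, meets a kernel escape; the first order escaping is
`1072 = 3·(3·7·17) + 1`, shape `(3,7,17)`).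
-/

namespace Summit.MatrixMultiplication.OmegaCensus

open Finset

section DihedralLike

variable {A : Type} [AddCommGroup A] [DecidableEq A] [Fintype A] {G : Type} [Group G] [DecidableEq G]
  {ρ τ : A → G} {c₀ : A} {S T U : Finset G}

open Literature.Combinatorics.Additive

/-- **No `|A| ≡ 1 (mod 3)` law over `A ↠ ℤ₄ × ℤ₄` unless `(|A|−1)/3` has a factorisation into three parts avoiding the
kernel shapes**: if every factorisation `cde = (|A| − 1)/3` has a part `1`, or two parts `3`, or parts `3` and `5`, or two
parts `5`, or two parts `7`, then no dihedral-like group over `A` (any `c₀`) has a TPP triple attaining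
`3|S||T||U| + 8 = 8|A|`. [folklore] -/
theorem no_mod_one_law_of_onto_z4z4_threeset
    (hρρ : ∀ a b, ρ a * ρ b = ρ (a + b)) (hρτ : ∀ a b, ρ a * τ b = τ (b - a))
    (hτρ : ∀ a b, τ a * ρ b = τ (a + b)) (hττ : ∀ a b, τ a * τ b = ρ (c₀ + b - a))
    (hρ : Function.Injective ρ) (hτ : Function.Injective τ) (hne : ∀ a b, ρ a ≠ τ b)
    (hsurj : ∀ g, (∃ a, ρ a = g) ∨ (∃ a, τ a = g)) (hA : 14 ≤ Fintype.card A)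
    (φ : A →+ ZMod 4 × ZMod 4) (hφ : Function.Surjective φ)
    (hq : ∀ c d e : ℕ, 3 * (c * d * e) + 1 = Fintype.card A →
      (c = 1 ∨ d = 1 ∨ e = 1) ∨ ((c = 3 ∧ d = 3) ∨ (d = 3 ∧ e = 3) ∨ (c = 3 ∧ e = 3)) ∨
      ((c = 3 ∧ d = 5) ∨ (d = 3 ∧ e = 5) ∨ (e = 3 ∧ c = 5) ∨ (c = 5 ∧ d = 3) ∨ (d = 5 ∧ e = 3) ∨ (e = 5 ∧ c = 3)) ∨
      ((c = 5 ∧ d = 5) ∨ (d = 5 ∧ e = 5) ∨ (e = 5 ∧ c = 5)) ∨ ((c = 7 ∧ d = 7) ∨ (d = 7 ∧ e = 7) ∨ (e = 7 ∧ c = 7)))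
    (h : TripleProductProperty S T U) : 3 * (S.card * T.card * U.card) + 8 ≠ 8 * Fintype.card A := by
  intro hV
  have hmod : Fintype.card A % 3 = 1 := by omega
  by_cases hnc : ((univ.filter fun a : A => ρ a ∈ S).card = (univ.filter fun a : A => τ a ∈ S).card ∧
      (univ.filter fun a : A => ρ a ∈ T).card = (univ.filter fun a : A => τ a ∈ T).card ∧
      (univ.filter fun a : A => ρ a ∈ U).card = (univ.filter fun a : A => τ a ∈ U).card)
  · obtain ⟨hS', hT', hU'⟩ := hnc
    have cS := card_eq_parts' hρ hτ hne hsurj S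
    have cT := card_eq_parts' hρ hτ hne hsurj T
    have cU := card_eq_parts' hρ hτ hne hsurj U
    set s₀ := (univ.filter fun a : A => ρ a ∈ S).card with hs₀
    set t₀ := (univ.filter fun a : A => ρ a ∈ T).card with ht₀
    set u₀ := (univ.filter fun a : A => ρ a ∈ U).card with hu₀
    have eS : S.card = 2 * s₀ := by rw [cS, ← hS']; ring
    have eT : T.card = 2 * t₀ := by rw [cT, ← hT']; ring
    have eU : U.card = 2 * u₀ := by rw [cU, ← hU']; ring
    have hprod : 3 * (s₀ * t₀ * u₀) + 1 = Fintype.card A := by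
      rw [eS, eT, eU] at hV; nlinarith
    rcases hq s₀ t₀ u₀ hprod with h1 | (⟨h3, h3'⟩ | ⟨h3, h3'⟩ | ⟨h3, h3'⟩) | h35 | h55 | h77
    · exact no_law_cube_one_of_onto_z4z4 hρρ hρτ hτρ hττ hρ hτ hne hsurj φ hφ h hS' hT' hU' h1 hV
    · exact no_law_cube_33e_of_onto_z4z4 hρρ hρτ hτρ hττ hρ hτ hne hsurj φ hφ h h3 (hS' ▸ h3) h3' (hT' ▸ h3') hU' hV
    · exact no_law_cube_e33_of_onto_z4z4 hρρ hρτ hτρ hττ hρ hτ hne hsurj φ hφ h hS' h3 (hT' ▸ h3) h3' (hU' ▸ h3') hV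
    · exact no_law_cube_3e3_of_onto_z4z4 hρρ hρτ hτρ hττ hρ hτ hne hsurj φ hφ h h3 (hS' ▸ h3) hT' h3' (hU' ▸ h3') hV
    · exact no_law_cube_three_five_of_onto_z4z4 hρρ hρτ hτρ hττ hρ hτ hne hsurj φ hφ h hS' hT' hU' h35 hV
    · exact no_law_cube_five_five_of_onto_z4z4 hρρ hρτ hτρ hττ hρ hτ hne hsurj φ hφ h hS' hT' hU' h55 hV
    · exact no_law_cube_seven_seven_of_onto_z4z4 hρρ hρτ hτρ hττ hρ hτ hne hsurj φ hφ h hS' hT' hU' h77 hV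
  · obtain ⟨g, a, b, hab⟩ :=
      two_cosets_of_mod_one_law_of_not_cube hρρ hρτ hτρ hττ hρ hτ hne hsurj hmod hA h hV hnc
    exact not_two_cosets_of_onto_z4z4 φ hφ g a b hab

/-- **Finite check: every factorisation `cde` with `3cde + 1 < 1072`, `16 ∣ 3cde + 1` meets one of the kernel escapes**
(a part `1`, two parts `3`, parts `3` and `5`, two parts `5`, two parts `7`); `decide` over `cde ≤ 356`. [folklore] -/
theorem cube_factor_table_lt_1072 : ∀ c ∈ List.range 357, ∀ d ∈ List.range (356 / c + 1),
    ∀ e ∈ List.range (356 / (c * d) + 1), (3 * (c * d * e) + 1) % 16 = 0 → 3 * (c * d * e) + 1 < 1072 →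
    ((c = 1 ∨ d = 1 ∨ e = 1) ∨ ((c = 3 ∧ d = 3) ∨ (d = 3 ∧ e = 3) ∨ (c = 3 ∧ e = 3)) ∨
      ((c = 3 ∧ d = 5) ∨ (d = 3 ∧ e = 5) ∨ (e = 3 ∧ c = 5) ∨ (c = 5 ∧ d = 3) ∨ (d = 5 ∧ e = 3) ∨ (e = 5 ∧ c = 3)) ∨
      ((c = 5 ∧ d = 5) ∨ (d = 5 ∧ e = 5) ∨ (e = 5 ∧ c = 5)) ∨ ((c = 7 ∧ d = 7) ∨ (d = 7 ∧ e = 7) ∨ (e = 7 ∧ c = 7))) := by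
  decide +kernel

/-- **Orders below `1072`.**  If `3cde + 1 = n < 1072` and `16 ∣ n`, then `(c, d, e)` has a part `1`, or two parts `3`, or
parts `3` and `5`, or two parts `5`, or two parts `7` (the first order escaping is `1072 = 3·(3·7·17) + 1`). [folklore] -/
theorem cube_factor_of_lt_1072 {c d e n : ℕ} (h : 3 * (c * d * e) + 1 = n) (hn : n < 1072) (h16 : 16 ∣ n) :
    ((c = 1 ∨ d = 1 ∨ e = 1) ∨ ((c = 3 ∧ d = 3) ∨ (d = 3 ∧ e = 3) ∨ (c = 3 ∧ e = 3)) ∨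
      ((c = 3 ∧ d = 5) ∨ (d = 3 ∧ e = 5) ∨ (e = 3 ∧ c = 5) ∨ (c = 5 ∧ d = 3) ∨ (d = 5 ∧ e = 3) ∨ (e = 5 ∧ c = 3)) ∨
      ((c = 5 ∧ d = 5) ∨ (d = 5 ∧ e = 5) ∨ (e = 5 ∧ c = 5)) ∨ ((c = 7 ∧ d = 7) ∨ (d = 7 ∧ e = 7) ∨ (e = 7 ∧ c = 7))) := by
  subst h
  have hm : c * d * e ≤ 356 := by omega
  have hc0 : c ≠ 0 := by rintro rfl; simp at h16
  have hd0 : d ≠ 0 := by rintro rfl; simp at h16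
  have he0 : e ≠ 0 := by rintro rfl; simp at h16
  have hc : c < 357 := by
    have : c ≤ c * d * e := by
      calc c = c * 1 * 1 := by ring
        _ ≤ c * d * e := by gcongr <;> omega
    omega
  have hd : d < 356 / c + 1 := by
    rw [Nat.lt_add_one_iff, Nat.le_div_iff_mul_le (Nat.pos_of_ne_zero hc0)]
    calc d * c = c * d * 1 := by ring
      _ ≤ c * d * e := by gcongr; omega
      _ ≤ 356 := hm
  have he : e < 356 / (c * d) + 1 := by
    rw [Nat.lt_add_one_iff, Nat.le_div_iff_mul_le (Nat.pos_of_ne_zero (mul_ne_zero hc0 hd0))]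
    calc e * (c * d) = c * d * e := by ring
      _ ≤ 356 := hm
  exact cube_factor_table_lt_1072 c (List.mem_range.2 hc) d (List.mem_range.2 hd) e (List.mem_range.2 he)
    (Nat.mod_eq_zero_of_dvd h16) (by omega)

/-- **THE `ℤ₄²`-QUOTIENT COLUMN BELOW `1072`.**  Let `A` be a finite abelian group with a surjection `φ : A →+ ZMod 4 × ZMod 4`
and `|A| < 1072`.  Then NO dihedral-like group over `A` (any `c₀`; `c₀ = 0` is `Dih(A)`, `2c₀ = 0 ≠ c₀` the generalized
dicyclic presentations) has a TPP triple attaining the law `3|S||T||U| + 8 = 8|A|` — uniform domino theorem (gen 16),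
`(3,3,e)` (gen 14), `(3,5,e)`, `(5,5,e)`, `(7,7,e)` (gen 17) and `cube_factor_of_lt_1072`; the non-cube shapes by
`two_cosets_of_mod_one_law_of_not_cube` / `not_two_cosets_of_onto_z4z4`.  In particular every order
`16, 64, 112, …, 976, 1024` of the classification table is closed for every `A` with a `ℤ₄ × ℤ₄` quotient. [folklore] -/
theorem no_mod_one_law_of_onto_z4z4_card_lt_1072
    (hρρ : ∀ a b, ρ a * ρ b = ρ (a + b)) (hρτ : ∀ a b, ρ a * τ b = τ (b - a))
    (hτρ : ∀ a b, τ a * ρ b = τ (a + b)) (hττ : ∀ a b, τ a * τ b = ρ (c₀ + b - a))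
    (hρ : Function.Injective ρ) (hτ : Function.Injective τ) (hne : ∀ a b, ρ a ≠ τ b)
    (hsurj : ∀ g, (∃ a, ρ a = g) ∨ (∃ a, τ a = g))
    (φ : A →+ ZMod 4 × ZMod 4) (hφ : Function.Surjective φ) (hA : Fintype.card A < 1072)
    (h : TripleProductProperty S T U) : 3 * (S.card * T.card * U.card) + 8 ≠ 8 * Fintype.card A := by
  have h16 : Fintype.card (ZMod 4 × ZMod 4) ∣ Fintype.card A := by
    rw [← Nat.card_eq_fintype_card, ← Nat.card_eq_fintype_card]
    exact AddSubgroup.card_dvd_of_surjective φ hφ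
  have hc16 : Fintype.card (ZMod 4 × ZMod 4) = 16 := by simp
  rw [hc16] at h16
  have hpos : 0 < Fintype.card A := Fintype.card_pos
  have hA14 : 14 ≤ Fintype.card A := by obtain ⟨k, hk⟩ := h16; omega
  exact no_mod_one_law_of_onto_z4z4_threeset hρρ hρτ hτρ hττ hρ hτ hne hsurj hA14 φ hφ
    (fun c d e hcde => cube_factor_of_lt_1072 hcde hA h16) h

/-- **`|A| = 496` (`(496−1)/3 = 165 = 3·5·11`), `A ↠ ℤ₄ × ℤ₄`: no dihedral-like group over `A` (any `c₀`) has a TPP triple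
attaining `3|S||T||U| + 8 = 8|A|`.** [folklore] -/
theorem no_mod_one_law_card_496_of_onto_z4z4
    (hρρ : ∀ a b, ρ a * ρ b = ρ (a + b)) (hρτ : ∀ a b, ρ a * τ b = τ (b - a))
    (hτρ : ∀ a b, τ a * ρ b = τ (a + b)) (hττ : ∀ a b, τ a * τ b = ρ (c₀ + b - a))
    (hρ : Function.Injective ρ) (hτ : Function.Injective τ) (hne : ∀ a b, ρ a ≠ τ b)
    (hsurj : ∀ g, (∃ a, ρ a = g) ∨ (∃ a, τ a = g)) (hA : Fintype.card A = 496)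
    (φ : A →+ ZMod 4 × ZMod 4) (hφ : Function.Surjective φ) (h : TripleProductProperty S T U) :
    3 * (S.card * T.card * U.card) + 8 ≠ 8 * Fintype.card A :=
  no_mod_one_law_of_onto_z4z4_card_lt_1072 hρρ hρτ hτρ hττ hρ hτ hne hsurj φ hφ (by rw [hA]; norm_num) h

/-- **`|A| = 736` (`(736−1)/3 = 245 = 5·7·7`), `A ↠ ℤ₄ × ℤ₄`: no dihedral-like group over `A` (any `c₀`) has a TPP triple
attaining `3|S||T||U| + 8 = 8|A|`.** [folklore] -/
theorem no_mod_one_law_card_736_of_onto_z4z4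
    (hρρ : ∀ a b, ρ a * ρ b = ρ (a + b)) (hρτ : ∀ a b, ρ a * τ b = τ (b - a))
    (hτρ : ∀ a b, τ a * ρ b = τ (a + b)) (hττ : ∀ a b, τ a * τ b = ρ (c₀ + b - a))
    (hρ : Function.Injective ρ) (hτ : Function.Injective τ) (hne : ∀ a b, ρ a ≠ τ b)
    (hsurj : ∀ g, (∃ a, ρ a = g) ∨ (∃ a, τ a = g)) (hA : Fintype.card A = 736)
    (φ : A →+ ZMod 4 × ZMod 4) (hφ : Function.Surjective φ) (h : TripleProductProperty S T U) :
    3 * (S.card * T.card * U.card) + 8 ≠ 8 * Fintype.card A :=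
  no_mod_one_law_of_onto_z4z4_card_lt_1072 hρρ hρτ hτρ hττ hρ hτ hne hsurj φ hφ (by rw [hA]; norm_num) h

/-- **`|A| = 976` (`(976−1)/3 = 325 = 5·5·13`), `A ↠ ℤ₄ × ℤ₄`: no dihedral-like group over `A` (any `c₀`) has a TPP triple
attaining `3|S||T||U| + 8 = 8|A|`.** [folklore] -/
theorem no_mod_one_law_card_976_of_onto_z4z4
    (hρρ : ∀ a b, ρ a * ρ b = ρ (a + b)) (hρτ : ∀ a b, ρ a * τ b = τ (b - a))
    (hτρ : ∀ a b, τ a * ρ b = τ (a + b)) (hττ : ∀ a b, τ a * τ b = ρ (c₀ + b - a))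
    (hρ : Function.Injective ρ) (hτ : Function.Injective τ) (hne : ∀ a b, ρ a ≠ τ b)
    (hsurj : ∀ g, (∃ a, ρ a = g) ∨ (∃ a, τ a = g)) (hA : Fintype.card A = 976)
    (φ : A →+ ZMod 4 × ZMod 4) (hφ : Function.Surjective φ) (h : TripleProductProperty S T U) :
    3 * (S.card * T.card * U.card) + 8 ≠ 8 * Fintype.card A :=
  no_mod_one_law_of_onto_z4z4_card_lt_1072 hρρ hρτ hτρ hττ hρ hτ hne hsurj φ hφ (by rw [hA]; norm_num) h

end DihedralLike

/-! ## Instances: the three census cells as named groups -/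

section Instances

variable {G : Type} [Group G] [DecidableEq G] {S T U : Finset G}

open Literature.Combinatorics.Additive

/-- **`ℤ₄ × ℤ₄ × ℤ₃₁` (`≅ ℤ₄ × ℤ₁₂₄`, order `496`)**: no dihedral-like group over it (any `c₀`; `c₀ = 0` is `Dih`) has a TPP
triple with `3|S||T||U| + 8 = 8 · 496` — census cell `(3,5,11)` at `496`, KERNEL (whole order). [folklore] -/
theorem no_mod_one_law_z4_z4_z31 {ρ τ : ZMod 4 × (ZMod 4 × ZMod 31) → G} {c₀ : ZMod 4 × (ZMod 4 × ZMod 31)}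
    (hρρ : ∀ a b, ρ a * ρ b = ρ (a + b)) (hρτ : ∀ a b, ρ a * τ b = τ (b - a))
    (hτρ : ∀ a b, τ a * ρ b = τ (a + b)) (hττ : ∀ a b, τ a * τ b = ρ (c₀ + b - a))
    (hρ : Function.Injective ρ) (hτ : Function.Injective τ) (hne : ∀ a b, ρ a ≠ τ b)
    (hsurj : ∀ g, (∃ a, ρ a = g) ∨ (∃ a, τ a = g)) (h : TripleProductProperty S T U) :
    3 * (S.card * T.card * U.card) + 8 ≠ 8 * Fintype.card (ZMod 4 × (ZMod 4 × ZMod 31)) :=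
  no_mod_one_law_card_496_of_onto_z4z4 hρρ hρτ hτρ hττ hρ hτ hne hsurj (by simp) _ (z4_z4_zn_onto_z4z4 31) h

/-- **`ℤ₄ × ℤ₈ × ℤ₂₃` (`≅ ℤ₄ × ℤ₁₈₄`, order `736`)**: no dihedral-like group over it (any `c₀`) has a TPP triple with
`3|S||T||U| + 8 = 8 · 736` — census cell `(5,7,7)` at `736`, KERNEL (whole order). [folklore] -/
theorem no_mod_one_law_z4_z8_z23 {ρ τ : ZMod 4 × (ZMod 8 × ZMod 23) → G} {c₀ : ZMod 4 × (ZMod 8 × ZMod 23)}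
    (hρρ : ∀ a b, ρ a * ρ b = ρ (a + b)) (hρτ : ∀ a b, ρ a * τ b = τ (b - a))
    (hτρ : ∀ a b, τ a * ρ b = τ (a + b)) (hττ : ∀ a b, τ a * τ b = ρ (c₀ + b - a))
    (hρ : Function.Injective ρ) (hτ : Function.Injective τ) (hne : ∀ a b, ρ a ≠ τ b)
    (hsurj : ∀ g, (∃ a, ρ a = g) ∨ (∃ a, τ a = g)) (h : TripleProductProperty S T U) :
    3 * (S.card * T.card * U.card) + 8 ≠ 8 * Fintype.card (ZMod 4 × (ZMod 8 × ZMod 23)) :=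
  no_mod_one_law_card_736_of_onto_z4z4 hρρ hρτ hτρ hττ hρ hτ hne hsurj (by simp) _ (z4_z8_zn_onto_z4z4 23) h

/-- **`ℤ₄ × ℤ₄ × ℤ₆₁` (`≅ ℤ₄ × ℤ₂₄₄`, order `976`)**: no dihedral-like group over it (any `c₀`) has a TPP triple with
`3|S||T||U| + 8 = 8 · 976` — census cell `(5,5,13)` at `976`, KERNEL (whole order). [folklore] -/
theorem no_mod_one_law_z4_z4_z61 {ρ τ : ZMod 4 × (ZMod 4 × ZMod 61) → G} {c₀ : ZMod 4 × (ZMod 4 × ZMod 61)}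
    (hρρ : ∀ a b, ρ a * ρ b = ρ (a + b)) (hρτ : ∀ a b, ρ a * τ b = τ (b - a))
    (hτρ : ∀ a b, τ a * ρ b = τ (a + b)) (hττ : ∀ a b, τ a * τ b = ρ (c₀ + b - a))
    (hρ : Function.Injective ρ) (hτ : Function.Injective τ) (hne : ∀ a b, ρ a ≠ τ b)
    (hsurj : ∀ g, (∃ a, ρ a = g) ∨ (∃ a, τ a = g)) (h : TripleProductProperty S T U) :
    3 * (S.card * T.card * U.card) + 8 ≠ 8 * Fintype.card (ZMod 4 × (ZMod 4 × ZMod 61)) :=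
  no_mod_one_law_card_976_of_onto_z4z4 hρρ hρτ hτρ hττ hρ hτ hne hsurj (by simp) _ (z4_z4_zn_onto_z4z4 61) h

end Instances

end Summit.MatrixMultiplication.OmegaCensus
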